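import Mathlib
import Summits.ValiantsHypothesis.ValiantsHypothesis.Theorems.BorderApolarityToricFixedPointsToricLimitIsInitial
import Literature.Computability.AlgebraicComplexity.ApolarityAction
import Literature.Computability.AlgebraicComplexity.PolystabilityProofs
import Literature.Computability.AlgebraicComplexity.BorderApolarityMembership

/-!
# Border apolarity, crux `ToricWitnessObstructionQP` (stmt-ValiantsHypothesis-14753) — line `Sketch`,
# reshape 4, stub `stub_limitTransfer` (limit transfer)

Route `ValiantsHypothesis/BorderApolarity`, crux item `stmt-ValiantsHypothesis-14753`, line `Sketch`,
reshape 4, stub `stub_limitTransfer`.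

Setting.  A toric witness `(u, g, w, J)` has `J` equal, degree by degree (`k ≤ m`), to the Kuratowski
limit of the annihilators `Ann_k(Q_t)` along the toric curve `Q_t = u · diag((t+2)^w) · (g · det_m)`
(the two clauses (Li), (Ls) of `IsBorderApolarLimit`).  The normal form re-expresses the datum:
`w = w₁ + c`, `p⁻¹ u diag(s^{w₁}) u⁻¹ p = diag(s^{w'})` for all `s`, and
`g' · det_m = (p⁻¹ u) · (μ • g · det_m)` with `μ ≠ 0`.

Claim.  For `k ≤ m`, `J k = {D | pᵀ · D ∈ in_{w'}(Ann_k(g' · det_m))}`, the `pᵀ`-translate of the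
span of the lowest-`w'`-weight initial forms of `Ann_k(g' · det_m)`.

Proof.  (a) The two curves agree up to nonzero scalars:
`Q_t = ((t+2)^c)^m μ⁻¹ • p · diag((t+2)^{w'}) · (g' · det_m)` (homogeneity of `g · det_m`, the
conjugation identity and `linSubst_mul`).  (b) Nonzero scalars do not change annihilators, so
(Li), (Ls) transfer verbatim to the second curve.  (c) Crux 3's `stub_toricLimitIsInitial` computes the
Kuratowski limit along the second curve as the translated initial span.  (d) Kuratowski limits are
unique.
-/

open MvPolynomial Filter
open scoped BigOperators Matrix
open Literature.Computability.AlgebraicComplexity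
open Summit.ValiantsHypothesis.ValiantsHypothesis.Theorems.BorderApolarityToricFixedPoints
  (stub_toricLimitIsInitial tli_natCast_add_two_ne_zero)

-- the mandated summit-side namespace repeats a component by design (single-problem summit)
set_option linter.dupNamespace false

namespace Summit.ValiantsHypothesis.ValiantsHypothesis.Theorems.BorderApolarityToricWitnessObstructionQP

/-- **Uniqueness of Kuratowski limits.**  If `J` and `J'` are both degree-wise Kuratowski limits of
the annihilators along the same sequence `P`, then `J k = J' k` for all `k ≤ d`: an element of `J k`
is a limit of annihilators along the full sequence (Li), hence lies in `J' k` by (Ls) with `φ = id`.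
[folklore] -/
theorem lt_isBorderApolarLimit_unique {σ : Type*} {d : ℕ} {P : ℕ → MvPolynomial σ ℂ}
    {J J' : ℕ → Set (MvPolynomial σ ℂ)} (h : IsBorderApolarLimit d P J)
    (h' : IsBorderApolarLimit d P J') : ∀ k ≤ d, J k = J' k := by
  intro k hk
  ext D
  constructor
  · intro hD
    obtain ⟨Ds, hDs, hlim⟩ := h.1 k hk D hD
    exact h'.2 k hk D id Ds strictMono_id (fun t => hDs t) hlim
  · intro hD
    obtain ⟨Ds, hDs, hlim⟩ := h'.1 k hk D hD
    exact h.2 k hk D id Ds strictMono_id (fun t => hDs t) hlim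

/-- **Kuratowski limits only see annihilators.**  If two sequences `P`, `P'` have the same
annihilators term by term, then they have the same degree-wise Kuratowski limits. [folklore] -/
theorem lt_isBorderApolarLimit_congr {σ : Type*} {d : ℕ} {P P' : ℕ → MvPolynomial σ ℂ}
    (hPP' : ∀ (t : ℕ) (D : MvPolynomial σ ℂ), apolarAction D (P t) = 0 ↔ apolarAction D (P' t) = 0)
    {J : ℕ → Set (MvPolynomial σ ℂ)} (h : IsBorderApolarLimit d P J) :
    IsBorderApolarLimit d P' J := by
  refine ⟨fun k hk D hD => ?_, fun k hk D φ Ds hφ hDs hlim => ?_⟩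
  · obtain ⟨Ds, hDs, hlim⟩ := h.1 k hk D hD
    exact ⟨Ds, fun t => ⟨(hDs t).1, (hPP' t _).1 (hDs t).2⟩, hlim⟩
  · exact h.2 k hk D φ Ds hφ (fun t => ⟨(hDs t).1, (hPP' (φ t) _).2 (hDs t).2⟩) hlim

/-- **Nonzero scalars do not change annihilators.**  `D ⌟ (r • f) = 0 ↔ D ⌟ f = 0` for `r ≠ 0`.
[folklore] -/
theorem lt_apolarAction_smul_eq_zero_iff {σ : Type*} {r : ℂ} (hr : r ≠ 0)
    (D f : MvPolynomial σ ℂ) : apolarAction D (r • f) = 0 ↔ apolarAction D f = 0 := by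
  rw [apolarAction_smul_right, smul_eq_zero, or_iff_right hr]

/-- **The conjugation identity, solved for `u · diag`.**  From
`p⁻¹ u D u⁻¹ p = D'` one gets `u D = p D' (p⁻¹ u)`. [folklore] -/
theorem lt_mul_eq_of_conj {σ : Type*} [Fintype σ] [DecidableEq σ] (u p : GL σ ℂ)
    (D D' : Matrix σ σ ℂ)
    (hconj : ((p⁻¹ : GL σ ℂ) : Matrix σ σ ℂ) * (u : Matrix σ σ ℂ) * D *
      ((u⁻¹ : GL σ ℂ) : Matrix σ σ ℂ) * (p : Matrix σ σ ℂ) = D') :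
    (u : Matrix σ σ ℂ) * D = (p : Matrix σ σ ℂ) * D' * ((p⁻¹ * u : GL σ ℂ) : Matrix σ σ ℂ) := by
  rw [← hconj, Units.val_mul]
  simp only [Matrix.mul_assoc, Units.mul_inv_cancel_left, Units.inv_mul, Matrix.mul_one]

/-- **The two toric curves differ by nonzero scalars.**  With `w = w₁ + c`,
`p⁻¹ u diag(s^{w₁}) u⁻¹ p = diag(s^{w'})` and `g' · det_m = (p⁻¹ u) · (μ • g · det_m)`, for `s ≠ 0`
`u · diag(s^w) · (g · det_m) = ((s^c)^m μ⁻¹) • p · diag(s^{w'}) · (g' · det_m)`. [folklore] -/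
theorem lt_curve_eq_smul (m : ℕ) (u g p g' : GL (Fin m × Fin m) ℂ)
    (w : Fin m × Fin m → ℤ) (c : ℤ) (w₁ w' : Fin m × Fin m → ℕ) (μ : ℂ) (hμ : μ ≠ 0)
    (hw : ∀ i, w i = (w₁ i : ℤ) + c)
    (hconj : ∀ s : ℂ, ((p⁻¹ : GL (Fin m × Fin m) ℂ) : Matrix (Fin m × Fin m) (Fin m × Fin m) ℂ) *
        (u : Matrix (Fin m × Fin m) (Fin m × Fin m) ℂ) * Matrix.diagonal (fun k => s ^ (w₁ k)) *
        ((u⁻¹ : GL (Fin m × Fin m) ℂ) : Matrix (Fin m × Fin m) (Fin m × Fin m) ℂ) *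
        (p : Matrix (Fin m × Fin m) (Fin m × Fin m) ℂ) = Matrix.diagonal (fun k => s ^ (w' k)))
    (hFg' : linSubst (Fin m × Fin m) ℂ (g' : Matrix (Fin m × Fin m) (Fin m × Fin m) ℂ)
        (detPoly (Fin m) ℂ) =
      linSubst (Fin m × Fin m) ℂ
        ((p⁻¹ * u : GL (Fin m × Fin m) ℂ) : Matrix (Fin m × Fin m) (Fin m × Fin m) ℂ)
        (μ • linSubst (Fin m × Fin m) ℂ (g : Matrix (Fin m × Fin m) (Fin m × Fin m) ℂ)
          (detPoly (Fin m) ℂ)))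
    (s : ℂ) (hs : s ≠ 0) :
    linSubst (Fin m × Fin m) ℂ (u : Matrix (Fin m × Fin m) (Fin m × Fin m) ℂ)
        (linSubst (Fin m × Fin m) ℂ (Matrix.diagonal fun i : Fin m × Fin m => s ^ (w i))
          (linSubst (Fin m × Fin m) ℂ (g : Matrix (Fin m × Fin m) (Fin m × Fin m) ℂ)
            (detPoly (Fin m) ℂ))) =
      ((s ^ c) ^ m * μ⁻¹) •
        linSubst (Fin m × Fin m) ℂ (p : Matrix (Fin m × Fin m) (Fin m × Fin m) ℂ)
          (linSubst (Fin m × Fin m) ℂ (Matrix.diagonal fun i : Fin m × Fin m => s ^ ((w' i : ℤ)))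
            (linSubst (Fin m × Fin m) ℂ (g' : Matrix (Fin m × Fin m) (Fin m × Fin m) ℂ)
              (detPoly (Fin m) ℂ))) := by
  set F := linSubst (Fin m × Fin m) ℂ (g : Matrix (Fin m × Fin m) (Fin m × Fin m) ℂ)
    (detPoly (Fin m) ℂ)
  -- `F` is a form of degree `m`
  have hFhom : F.IsHomogeneous m := by
    have h := linSubst_isHomogeneous (g : Matrix (Fin m × Fin m) (Fin m × Fin m) ℂ)
      (detPoly_isHomogeneous (n := Fin m) (k := ℂ))
    rwa [Fintype.card_fin] at h
  -- `diag(s^w) = s^c • diag(s^{w₁})`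
  have hdiag : (Matrix.diagonal fun i : Fin m × Fin m => s ^ (w i)) =
      (s ^ c) • Matrix.diagonal (fun k : Fin m × Fin m => s ^ (w₁ k)) := by
    rw [← Matrix.diagonal_smul]
    congr 1
    funext i
    rw [Pi.smul_apply, smul_eq_mul, hw i, zpow_add₀ hs, zpow_natCast, mul_comm]
  -- `diag(s^{w'})` with natural and with integer exponents
  have hdiag' : (Matrix.diagonal fun k : Fin m × Fin m => s ^ (w' k)) =
      Matrix.diagonal fun i : Fin m × Fin m => s ^ ((w' i : ℤ)) := by
    simp only [zpow_natCast]
  -- `(p⁻¹ u) · F = μ⁻¹ • F'`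
  have hF' : linSubst (Fin m × Fin m) ℂ
      ((p⁻¹ * u : GL (Fin m × Fin m) ℂ) : Matrix (Fin m × Fin m) (Fin m × Fin m) ℂ) F =
      μ⁻¹ • linSubst (Fin m × Fin m) ℂ (g' : Matrix (Fin m × Fin m) (Fin m × Fin m) ℂ)
        (detPoly (Fin m) ℂ) := by
    rw [hFg', map_smul, smul_smul, inv_mul_cancel₀ hμ, one_smul]
  have hmat := lt_mul_eq_of_conj u p _ _ (hconj s)
  rw [hdiag, linSubst_smul_of_isHomogeneous hFhom, map_smul, ← AlgHom.comp_apply, ← linSubst_mul,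
    hmat, linSubst_mul, linSubst_mul, AlgHom.comp_apply, AlgHom.comp_apply, hF', map_smul, map_smul,
    smul_smul, hdiag']

/-- **Limit transfer, `IsBorderApolarLimit` form.**  If `J` is the degree-wise Kuratowski limit of the
annihilators along the toric curve of `(u, g, w)` and the datum is re-expressed as in
`lt_curve_eq_smul`, then `J k` (`k ≤ m`) is the `pᵀ`-translate of the lowest-`w'`-weight initial span
of `Ann_k(g' · det_m)`: transfer of the two Kuratowski clauses along the rescaled curve, crux 3's
`stub_toricLimitIsInitial`, and uniqueness of Kuratowski limits. [folklore] -/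
theorem lt_limitTransfer_main (m : ℕ) (J : ℕ → Set (MvPolynomial (Fin m × Fin m) ℂ))
    (u g p g' : GL (Fin m × Fin m) ℂ) (w : Fin m × Fin m → ℤ) (c : ℤ) (w₁ w' : Fin m × Fin m → ℕ)
    (μ : ℂ) (hμ : μ ≠ 0) (hw : ∀ i, w i = (w₁ i : ℤ) + c)
    (hconj : ∀ s : ℂ, ((p⁻¹ : GL (Fin m × Fin m) ℂ) : Matrix (Fin m × Fin m) (Fin m × Fin m) ℂ) *
        (u : Matrix (Fin m × Fin m) (Fin m × Fin m) ℂ) * Matrix.diagonal (fun k => s ^ (w₁ k)) *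
        ((u⁻¹ : GL (Fin m × Fin m) ℂ) : Matrix (Fin m × Fin m) (Fin m × Fin m) ℂ) *
        (p : Matrix (Fin m × Fin m) (Fin m × Fin m) ℂ) = Matrix.diagonal (fun k => s ^ (w' k)))
    (hFg' : linSubst (Fin m × Fin m) ℂ (g' : Matrix (Fin m × Fin m) (Fin m × Fin m) ℂ)
        (detPoly (Fin m) ℂ) =
      linSubst (Fin m × Fin m) ℂ
        ((p⁻¹ * u : GL (Fin m × Fin m) ℂ) : Matrix (Fin m × Fin m) (Fin m × Fin m) ℂ)
        (μ • linSubst (Fin m × Fin m) ℂ (g : Matrix (Fin m × Fin m) (Fin m × Fin m) ℂ)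
          (detPoly (Fin m) ℂ)))
    (hlim : IsBorderApolarLimit m
      (fun t : ℕ => linSubst (Fin m × Fin m) ℂ (u : Matrix (Fin m × Fin m) (Fin m × Fin m) ℂ)
        (linSubst (Fin m × Fin m) ℂ
          (Matrix.diagonal fun i : Fin m × Fin m => ((t : ℂ) + 2) ^ (w i))
          (linSubst (Fin m × Fin m) ℂ (g : Matrix (Fin m × Fin m) (Fin m × Fin m) ℂ)
            (detPoly (Fin m) ℂ)))) J)
    (k : ℕ) (hk : k ≤ m) :
    J k = {D | linSubst (Fin m × Fin m) ℂ (p : Matrix (Fin m × Fin m) (Fin m × Fin m) ℂ)ᵀ D ∈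
      Submodule.span ℂ {D' : MvPolynomial (Fin m × Fin m) ℂ |
        ∃ E ∈ annihilatorOfDegree
          (linSubst (Fin m × Fin m) ℂ (g' : Matrix (Fin m × Fin m) (Fin m × Fin m) ℂ) (detPoly (Fin m) ℂ)) k,
        ∃ ν : ℤ, D' = weightedHomogeneousComponent (fun i => (w' i : ℤ)) ν E ∧
          ∀ ν' : ℤ, ν' < ν → weightedHomogeneousComponent (fun i => (w' i : ℤ)) ν' E = 0}} := by
  -- (a) + (b): transfer the two Kuratowski clauses to the second curve
  have hlim' : IsBorderApolarLimit m
      (fun t : ℕ => linSubst (Fin m × Fin m) ℂ (p : Matrix (Fin m × Fin m) (Fin m × Fin m) ℂ)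
        (linSubst (Fin m × Fin m) ℂ
          (Matrix.diagonal fun i : Fin m × Fin m => ((t : ℂ) + 2) ^ ((fun i => (w' i : ℤ)) i))
          (linSubst (Fin m × Fin m) ℂ (g' : Matrix (Fin m × Fin m) (Fin m × Fin m) ℂ)
            (detPoly (Fin m) ℂ)))) J := by
    refine lt_isBorderApolarLimit_congr (fun t D => ?_) hlim
    have hs : ((t : ℂ) + 2) ≠ 0 := tli_natCast_add_two_ne_zero t
    have hr : (((t : ℂ) + 2) ^ c) ^ m * μ⁻¹ ≠ 0 :=
      mul_ne_zero (pow_ne_zero _ (zpow_ne_zero _ hs)) (inv_ne_zero hμ)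
    rw [lt_curve_eq_smul m u g p g' w c w₁ w' μ hμ hw hconj hFg' _ hs,
      lt_apolarAction_smul_eq_zero_iff hr]
  -- (c) + (d): the limit along the second curve is the translated initial span; limits are unique
  exact lt_isBorderApolarLimit_unique hlim'
    (stub_toricLimitIsInitial m p (fun i => (w' i : ℤ))
      (linSubst (Fin m × Fin m) ℂ (g' : Matrix (Fin m × Fin m) (Fin m × Fin m) ℂ) (detPoly (Fin m) ℂ)))
    k hk

/-- **Stub 2 — limit transfer.**  If the toric curve of `(u, g, w)` is re-expressed through a second
datum — `w = w₁ + c`, `u · diag(s^{w₁}) · u⁻¹ = p · diag(s^{w'}) · p⁻¹` for all `s`, and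
`g' · det_m = (p⁻¹ u) · (μ • g · det_m)` — then the two curves differ by nonzero scalars, so the
Kuratowski limit `J` of `Ann_k(Q_t)` (W2 ∧ W3) is, degree by degree, the `pᵀ`-translate of the
lowest-`w'`-weight initial span of `Ann_k(g' · det_m)` (crux 3's `stub_toricLimitIsInitial` +
uniqueness of Kuratowski limits). [folklore] -/
theorem stub_limitTransfer : ∀ (m : ℕ) [NeZero m]
    (J : ℕ → Set (MvPolynomial (Fin m × Fin m) ℂ)) (u g p g' : GL (Fin m × Fin m) ℂ)
    (w : Fin m × Fin m → ℤ) (c : ℤ) (w₁ w' : Fin m × Fin m → ℕ) (μ : ℂ),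
    μ ≠ 0 → (∀ i, w i = (w₁ i : ℤ) + c) →
    (∀ s : ℂ, ((p⁻¹ : GL (Fin m × Fin m) ℂ) : Matrix (Fin m × Fin m) (Fin m × Fin m) ℂ) *
        (u : Matrix (Fin m × Fin m) (Fin m × Fin m) ℂ) * Matrix.diagonal (fun k => s ^ (w₁ k)) *
        ((u⁻¹ : GL (Fin m × Fin m) ℂ) : Matrix (Fin m × Fin m) (Fin m × Fin m) ℂ) *
        (p : Matrix (Fin m × Fin m) (Fin m × Fin m) ℂ) = Matrix.diagonal (fun k => s ^ (w' k))) →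
    linSubst (Fin m × Fin m) ℂ (g' : Matrix (Fin m × Fin m) (Fin m × Fin m) ℂ) (detPoly (Fin m) ℂ) =
      linSubst (Fin m × Fin m) ℂ ((p⁻¹ * u : GL (Fin m × Fin m) ℂ) : Matrix (Fin m × Fin m) (Fin m × Fin m) ℂ)
        (μ • linSubst (Fin m × Fin m) ℂ (g : Matrix (Fin m × Fin m) (Fin m × Fin m) ℂ) (detPoly (Fin m) ℂ)) →
    (let Q : ℕ → MvPolynomial (Fin m × Fin m) ℂ := fun t =>
      linSubst (Fin m × Fin m) ℂ (u : Matrix (Fin m × Fin m) (Fin m × Fin m) ℂ)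
        (linSubst (Fin m × Fin m) ℂ (Matrix.diagonal fun i : Fin m × Fin m => ((t : ℂ) + 2) ^ (w i))
          (linSubst (Fin m × Fin m) ℂ (g : Matrix (Fin m × Fin m) (Fin m × Fin m) ℂ) (detPoly (Fin m) ℂ)))
     (∀ k ≤ m, ∀ D ∈ J k, ∃ Ds : ℕ → MvPolynomial (Fin m × Fin m) ℂ,
        (∀ t, (Ds t).IsHomogeneous k ∧ apolarAction (Ds t) (Q t) = 0) ∧
        Tendsto (fun t => coeffVec (Ds t)) atTop (nhds (coeffVec D))) ∧
     (∀ k ≤ m, ∀ (D : MvPolynomial (Fin m × Fin m) ℂ) (φ : ℕ → ℕ) (Ds : ℕ → MvPolynomial (Fin m × Fin m) ℂ),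
        StrictMono φ → (∀ t, (Ds t).IsHomogeneous k ∧ apolarAction (Ds t) (Q (φ t)) = 0) →
        Tendsto (fun t => coeffVec (Ds t)) atTop (nhds (coeffVec D)) → D ∈ J k)) →
    ∀ k ≤ m, J k = {D | linSubst (Fin m × Fin m) ℂ (p : Matrix (Fin m × Fin m) (Fin m × Fin m) ℂ)ᵀ D ∈
      Submodule.span ℂ {D' : MvPolynomial (Fin m × Fin m) ℂ |
        ∃ E ∈ annihilatorOfDegree
          (linSubst (Fin m × Fin m) ℂ (g' : Matrix (Fin m × Fin m) (Fin m × Fin m) ℂ) (detPoly (Fin m) ℂ)) k,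
        ∃ ν : ℤ, D' = weightedHomogeneousComponent (fun i => (w' i : ℤ)) ν E ∧
          ∀ ν' : ℤ, ν' < ν → weightedHomogeneousComponent (fun i => (w' i : ℤ)) ν' E = 0}} := by
  intro m _ J u g p g' w c w₁ w' μ hμ hw hconj hFg' hJ k hk
  -- the `let`-hypothesis is `IsBorderApolarLimit m Q J` for the first curve, by `rfl`
  exact lt_limitTransfer_main m J u g p g' w c w₁ w' μ hμ hw hconj hFg' hJ k hk

end Summit.ValiantsHypothesis.ValiantsHypothesis.Theorems.BorderApolarityToricWitnessObstructionQP
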